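import Mathlib
import Summits.PneNP.PneNP.Theses.OneSlice
import Summits.PneNP.PneNP.Theorems.OneSliceSliceTargetSplit

/-!
# Route OneSlice, crux `MonotoneContinuation` (stmt-PneNP-18471), line `Sketch_ideator1_r1` (ProfileLine) — stub binomialMixing

Two classical identities for the binomial weights `Bin(N,p)(s) = C(N,s) p^s (1-p)^{N-s}`, as pure finite
algebra over `ℝ` (no probability):

* THINNING: `Σ_{s=0}^{N} Bin(N,p)(s) · Bin(s,θ)(r) = Bin(N, pθ)(r)` — keep each of `Bin(N,p)` successes
  independently with probability `θ`. Proof: if `N < r` both sides vanish; otherwise write `N = r + M`,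
  split `range (r + (M + 1))` (`Finset.sum_range_add`), the first block vanishes (`C(s,r) = 0` for `s < r`),
  and on the second block `C(r+M, r+x) C(r+x, r) = C(r+M, r) C(M, x)` (`Nat.choose_mul`) reduces the claim,
  term by term, to the binomial expansion of `(1 - pθ)^M = (p(1-θ) + (1-p))^M` (`add_pow`).
* SUPERPOSITION (`r ≤ N`): `Σ_{s=0}^{r} Bin(N,p)(s) · Bin(N-s,θ)(r-s) = Bin(N, p+θ-pθ)(r)` — add an
  independent `Bin(N-s,θ)` on the failures. Proof: `C(N,s) C(N-s,r-s) = C(N,r) C(r,s)` (`Nat.choose_mul`),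
  `(1-p)^{N-s} = (1-p)^{r-s} (1-p)^{N-r}`, `1 - (p+θ-pθ) = (1-p)(1-θ)`, and the binomial expansion of
  `(p+θ-pθ)^r = (p + (1-p)θ)^r` (`add_pow`), term by term.
-/

set_option linter.dupNamespace false -- `Summit.PneNP.PneNP.…`: summit = sub-problem (D-0017)

namespace Summit.PneNP.PneNP.Theorems.MonotoneContinuation

open Literature.Computability.Complexity hiding supp mem_supp
open Finset hiding slice
open Filter hiding mem_sdiff
open Classical
open Summit.PneNP.PneNP.Theorems (binomialWeight_tail_le binomialWeight_sum_range binomialWeight_nonneg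
  binomialWeight_variance card_slice)
open Summit.PneNP.PneNP.Theorems.ConstantBand.Negative (Edge thr Central slice)
open Summit.PneNP.PneNP.Theorems.SingleThreshold.Negative (pc)
open Summit.PneNP.PneNP.Theorems.SliceACZero.Negative (supp mem_supp card_supp supp_injective supp_indicator)
open Summit.PneNP.PneNP.Theorems.SliceTargetSplit (Comp nbhd mem_nbhd transport ind l1 nbhdCard card_nbhd
  card_nbhd_of_le card_nbhd_of_ge choose_mul_nbhdCard nbhdCard_pos sum_slice_sum_nbhd sum_slice_sum_nbhd_left
  supp_subset_of_comp_of_le comp_iff_supp comp_comm ofSet supp_ofSet ofSet_supp edgeCount_ofSet ind_nonneg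
  ind_le_one abs_ind_sub_ind l1_triangle l1_comm l1_nonneg transport_nonneg transport_sub)

noncomputable section

variable {n : ℕ}

/-- Thinning of binomial weights: `Σ_{s ≤ N} C(N,s) p^s (1-p)^{N-s} · C(s,r) θ^r (1-θ)^{s-r}
= C(N,r) (pθ)^r (1-pθ)^{N-r}`. [folklore] -/
private theorem binomialMixing_thin (N r : ℕ) (p θ : ℝ) :
    ∑ s ∈ range (N + 1), ((N.choose s : ℝ) * p ^ s * (1 - p) ^ (N - s)) *
        ((s.choose r : ℝ) * θ ^ r * (1 - θ) ^ (s - r)) =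
      (N.choose r : ℝ) * (p * θ) ^ r * (1 - p * θ) ^ (N - r) := by
  rcases lt_or_ge N r with hNr | hrN
  · -- `N < r`: every term, and the right-hand side, vanishes
    rw [Nat.choose_eq_zero_of_lt hNr, Nat.cast_zero, zero_mul, zero_mul]
    refine sum_eq_zero fun s hs => ?_
    have hsr : s < r := by have := mem_range.1 hs; omega
    rw [Nat.choose_eq_zero_of_lt hsr, Nat.cast_zero]
    ring
  · -- `r ≤ N`: write `N = r + M` and reindex `s = r + x`
    obtain ⟨M, rfl⟩ := Nat.exists_eq_add_of_le hrN
    rw [show r + M + 1 = r + (M + 1) from rfl, sum_range_add]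
    rw [sum_eq_zero fun s hs => by
      rw [Nat.choose_eq_zero_of_lt (mem_range.1 hs), Nat.cast_zero]; ring, zero_add]
    have key : (1 - p * θ) ^ (r + M - r) =
        ∑ x ∈ range (M + 1), p ^ x * (1 - θ) ^ x * (1 - p) ^ (M - x) * (M.choose x : ℝ) := by
      rw [Nat.add_sub_cancel_left, show 1 - p * θ = p * (1 - θ) + (1 - p) by ring, add_pow]
      exact sum_congr rfl fun x _ => by rw [mul_pow]
    rw [key, mul_pow, mul_sum]
    refine sum_congr rfl fun x hx => ?_
    have hxM : x ≤ M := Nat.lt_succ_iff.1 (mem_range.1 hx)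
    have hc := Nat.choose_mul (n := r + M) (k := r + x) (s := r) (Nat.le_add_right r x)
    simp only [Nat.add_sub_cancel_left] at hc
    have hc' : ((r + M).choose (r + x) : ℝ) * ((r + x).choose r : ℝ) =
        ((r + M).choose r : ℝ) * (M.choose x : ℝ) := by
      exact_mod_cast hc
    simp only [Nat.add_sub_add_left, Nat.add_sub_cancel_left]
    linear_combination (p ^ r * p ^ x * (1 - p) ^ (M - x) * θ ^ r * (1 - θ) ^ x) * hc'

/-- Superposition of binomial weights (`r ≤ N`): `Σ_{s ≤ r} C(N,s) p^s (1-p)^{N-s} · C(N-s,r-s) θ^{r-s}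
(1-θ)^{(N-s)-(r-s)} = C(N,r) (p+θ-pθ)^r (1-(p+θ-pθ))^{N-r}`. [folklore] -/
private theorem binomialMixing_sup (N r : ℕ) (p θ : ℝ) (hr : r ≤ N) :
    ∑ s ∈ range (r + 1), ((N.choose s : ℝ) * p ^ s * (1 - p) ^ (N - s)) *
        (((N - s).choose (r - s) : ℝ) * θ ^ (r - s) * (1 - θ) ^ (N - s - (r - s))) =
      (N.choose r : ℝ) * (p + θ - p * θ) ^ r * (1 - (p + θ - p * θ)) ^ (N - r) := by
  have key : (p + θ - p * θ) ^ r =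
      ∑ s ∈ range (r + 1), p ^ s * ((1 - p) ^ (r - s) * θ ^ (r - s)) * (r.choose s : ℝ) := by
    rw [show p + θ - p * θ = p + (1 - p) * θ by ring, add_pow]
    exact sum_congr rfl fun s _ => by rw [mul_pow]
  have hone : (1 - (p + θ - p * θ)) ^ (N - r) = (1 - p) ^ (N - r) * (1 - θ) ^ (N - r) := by
    rw [← mul_pow]
    congr 1
    ring
  rw [key, hone, mul_sum, sum_mul]
  refine sum_congr rfl fun s hs => ?_
  have hsr : s ≤ r := Nat.lt_succ_iff.1 (mem_range.1 hs)
  have hc' : (N.choose s : ℝ) * ((N - s).choose (r - s) : ℝ) = (N.choose r : ℝ) * (r.choose s : ℝ) := by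
    exact_mod_cast (Nat.choose_mul (n := N) hsr).symm
  have h1 : N - s - (r - s) = N - r := by omega
  have h2 : (1 - p) ^ (N - s) = (1 - p) ^ (r - s) * (1 - p) ^ (N - r) := by
    rw [← pow_add]
    congr 1
    omega
  rw [h1, h2]
  linear_combination (p ^ s * (1 - p) ^ (r - s) * (1 - p) ^ (N - r) * θ ^ (r - s) * (1 - θ) ^ (N - r)) * hc'

/-- **Binomial mixing** (the statement `BinomialMixing` of the line skeleton, written out).
Thinning: `Σ_{s ≤ N} Bin(N,p)(s) · Bin(s,θ)(r) = Bin(N,pθ)(r)`; superposition (`r ≤ N`):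
`Σ_{s ≤ r} Bin(N,p)(s) · Bin(N-s,θ)(r-s) = Bin(N, p+θ-pθ)(r)`, where `Bin(N,p)(r) = C(N,r) p^r (1-p)^{N-r}`.
[folklore] -/
theorem stub_binomialMixing :
  (∀ (N r : ℕ) (p θ : ℝ),
    ∑ s ∈ range (N + 1), ((N.choose s : ℝ) * p ^ s * (1 - p) ^ (N - s)) * ((s.choose r : ℝ) * θ ^ r * (1 - θ) ^ (s - r)) =
      (N.choose r : ℝ) * (p * θ) ^ r * (1 - p * θ) ^ (N - r)) ∧
  (∀ (N r : ℕ) (p θ : ℝ), r ≤ N →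
    ∑ s ∈ range (r + 1), ((N.choose s : ℝ) * p ^ s * (1 - p) ^ (N - s)) *
        (((N - s).choose (r - s) : ℝ) * θ ^ (r - s) * (1 - θ) ^ (N - s - (r - s))) =
      (N.choose r : ℝ) * (p + θ - p * θ) ^ r * (1 - (p + θ - p * θ)) ^ (N - r)) :=
  ⟨binomialMixing_thin, binomialMixing_sup⟩

end

end Summit.PneNP.PneNP.Theorems.MonotoneContinuation
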